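import Summits.BirchSwinnertonDyer.Rank1Residual.Additive.LocalTowerKernelPrimaryExact
import Summits.BirchSwinnertonDyer.BirchSwinnertonDyer.Theorems.ByReductionTypeAtTwoGoodOrdTowerControlCocycleFixed
import Summits.BirchSwinnertonDyer.BirchSwinnertonDyer.Theorems.ByReductionTypeAtTwoGoodOrdTowerCoinvCocycle
import Summits.BirchSwinnertonDyer.BirchSwinnertonDyer.Theorems.ByReductionTypeAtTwoGoodOrdTowerHensel
import Literature.NumberTheory.EllipticCurves.IsogenyQuotientPlacesProofs
import HarnessLib

/-!
# Route `ByReductionTypeAtTwo` (K4), TOWER road — Greenberg's `ker(r_{v_n}) ≅ H¹(Γ_v, ·)` EXACTLY at a place above `p`: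
# `#𝒦_{v,n}[p^∞] = #(E(K_{∞,η})/(g − 1)E(K_{∞,η}))[p^∞]` with NO divisibility hypothesis

Cell `bsd-2adic`, seat `bsd-2adic-tower-1` (GEN 25), `--supports stmt-BirchSwinnertonDyer-19271` (helper). TOOL theorems
only (no definition, no named fact, no `sorry`); closes nothing by itself; BSD is not proved by any of this. Part (a) of the
programme «Greenberg LNM 1716 Lemma 3.4 at layer `0` EXACT ⇒ Thm. 4.1 over `ℚ` ⇒ the `hEC` binder
`X5.TwoAdicEulerCharRankZero W 0` of the TOWER doors in the kernel» (sibling `…EulerCharLayerZero.lean`).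

The tree's local inflation–restriction (`ResKernel.exists_addMonoidHom_subgroupResKer_injective`, transported in
`MultTowerNS2.finite_torsionBy_localTowerKerPrimary_and_card_le` / `WeierstrassCurve.finite_localTowerKerPrimary_and_card_le`)
EMBEDS `𝒦_{E,n}[p^∞]` into the `p`-power torsion of the coinvariants `M_∞/(g − 1)M_∞`, `M_∞ = E(K̄_E)^{H_{E,∞}}`, `g` a
topological generator of `H_{E,n}` modulo `H_{E,∞}`. Cell b2b-bsdres (`Rank1Residual/Additive/LocalTowerKernelPrimaryExact`)
proved the embedding ONTO at `n = 0` when `M_∞` is `p`-divisible modulo its torsion — true at `v ∤ p`, false at `v ∣ p`.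
This file removes that hypothesis: the embedding is onto as soon as EVERY relation `p^k x = (g − 1) y` in `M_∞` is realised
by a continuous cocycle on `H_{E,n}` vanishing on `H_{E,∞}` with value `x` at `g` (§1–§2, any `K`, `E`, `n`), and at a place
`v ∣ p` of `ℚ` for the cyclotomic `ℤ_p`-extension this is this lineage's inflated cocycle
`GoodOrdTower.exists_contOneCocycles_inflate_pow_of_fixed` (GEN 20, BRICK B′ with `A₁ = E(K̄_v)`: the geometric sums of `x`
become `p^k`-torsion, `H_∞`-fixed, hence fixed at a finite level) (§3).

* §1 `natCard_primary_subgroupResKer_eq_of_cocycles` — generic: `#{x ∈ ker(res : H¹(G,M) → H¹(N,M)) : p-power torsion}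
  = #(M^N/(γ − 1)M^N)[p^∞]` given the cocycles.
* §2 `natCard_localTowerKerPrimary_eq_of_cocycles` — `#𝒦_{E,n}[p^∞] = #(M_∞/(g − 1)M_∞)[p^∞]` (any layer `n`).
* §3 **`natCard_localTowerKerPrimary_eq_coinv_atP`** — for `κ` the cyclotomic `ℤ_p`-extension of `ℚ`, `v ∋ p`, ANY `W/ℚ`,
  any layer `n` and the inertial generator `g` of `GoodOrdTower.exists_inertial_generator`:
  `#𝒦_{v,n}[p^∞] = #(E(K̄_v)^{H_∞}/(g − 1))[p^∞]` whenever the right side is finite.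

References: [GreenbergLNM1716] §3 Lemma 3.1 (p. 86), Lemma 3.4 (p. 89); [SerreGaloisCohomology1997] I.§2.6, XIII.§1.
-/

set_option autoImplicit false
-- justification: the mandated namespace `Summit.BirchSwinnertonDyer.BirchSwinnertonDyer.Theorems`
-- (single-conjunct summit, Sub = Summit) repeats a segment by design (D-0017).
set_option linter.dupNamespace false

noncomputable section

open scoped Classical

universe u

namespace Summit.BirchSwinnertonDyer.BirchSwinnertonDyer.Theorems.GoodOrdTower

open NumberField IsDedekindDomain Field Literature.NumberTheory.EllipticCurves
  Literature.NumberTheory.GaloisRepresentations Literature.NumberTheory.EllipticCurves.ResKernel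
  Literature.NumberTheory.EllipticCurves.PrimaryCoinvariants ZpExtension WeierstrassCurve

/-! ## §1 Generic: the `p`-primary evaluation embedding is onto, given the cocycles -/

section Generic

variable {G : Type u} [Group G] [TopologicalSpace G] [IsTopologicalGroup G]
  (N : Subgroup G) [N.Normal] (M : Type u) [AddCommGroup M] [DistribMulAction G M]
  [TopologicalSpace M] [DiscreteTopology M]

/-- **`#{x ∈ ker(res : H¹(G,M) → H¹(N,M)) : p-power torsion} = #(M^N/(γ−1)M^N)[p^∞]`** when `N` and `γ` generate `G`
topologically and (hinf) EVERY relation `p^k • x = (γ − 1) y` in `M^N` is realised by a continuous cocycle `ψ` on `G`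
vanishing on `N` with `ψ(γ) = x`: the tree's injective evaluation map (`exists_addMonoidHom_subgroupResKer_injective`) then
hits every `p`-power-torsion class, and the hit class is `p`-power torsion by injectivity. (The variant of
`Rank1Residual.Additive.natCard_primary_subgroupResKer_eq` without the `p`-divisibility hypothesis.)
[cite: GreenbergLNM1716, §3 Lemma 3.1 (p. 86)] -/
theorem natCard_primary_subgroupResKer_eq_of_cocycles (γ : G)
    (hgen : ∀ U : Subgroup G, IsOpen (U : Set G) → N ≤ U → γ ∈ U → U = ⊤)
    (hcont : ∀ m : M, Continuous fun g : G ↦ g • m) (p : ℕ)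
    (hinf : ∀ (x y : FixedPoints.addSubgroup N M) (k : ℕ), p ^ k • x = subOne N M γ y →
      ∃ ψ : contOneCocycles (discreteTopRep G M), (∀ n ∈ N, ψ.1 n = 0) ∧ ψ.1 γ = x)
    [Finite (AddCommGroup.primaryComponent
      (FixedPoints.addSubgroup N M ⧸ (subOne N M γ).range) p)] :
    Nat.card {x : subgroupResKer M N // ∃ k : ℕ, p ^ k • x = 0} =
      Nat.card (AddCommGroup.primaryComponent
        (FixedPoints.addSubgroup N M ⧸ (subOne N M γ).range) p) := by
  obtain ⟨w, hw, hwval⟩ := exists_addMonoidHom_subgroupResKer_injective N M γ hgen hcont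
  let f : {x : subgroupResKer M N // ∃ k : ℕ, p ^ k • x = 0} →
      AddCommGroup.primaryComponent (FixedPoints.addSubgroup N M ⧸ (subOne N M γ).range) p :=
    fun x ↦ ⟨w x.1, by
      obtain ⟨k, hk⟩ := x.2
      exact (AddCommGroup.mem_primaryComponent).mpr ⟨k, by rw [← map_nsmul, hk, map_zero]⟩⟩
  have hf : Function.Injective f := fun x y hxy ↦ Subtype.ext (hw (Subtype.ext_iff.mp hxy))
  have hfsurj : Function.Surjective f := by
    rintro ⟨q, hq⟩
    obtain ⟨k, hk⟩ := (AddCommGroup.mem_primaryComponent).mp hq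
    obtain ⟨m, rfl⟩ := QuotientAddGroup.mk_surjective q
    -- `p^k m = (γ - 1) y`
    rw [← QuotientAddGroup.mk_nsmul, QuotientAddGroup.eq_zero_iff] at hk
    obtain ⟨y, hy⟩ := hk
    obtain ⟨ψ, hψN, hψγ⟩ := hinf m y k hy.symm
    -- the class of `ψ` lies in `ker res` and maps to `[m]`
    have hmem : oneCocycleClass _ ψ ∈ subgroupResKer M N := by
      rw [mem_subgroupResKer_iff, ResKernel.resSubgroup_oneCocycleClass]
      have h0 : contOneCocycles.pullback (Literature.NumberTheory.EllipticCurves.subgroupIncl N)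
          (resHomOfEquivariant (Literature.NumberTheory.EllipticCurves.subgroupIncl N) (AddMonoidHom.id M)
            (fun _ _ ↦ rfl)) ψ = 0 := by
        apply Subtype.ext
        ext n
        rw [pullback_subtype_apply]
        exact hψN n n.2
      rw [h0, oneCocycleClass_zero]
    have hwx : w ⟨_, hmem⟩ = QuotientAddGroup.mk m := by
      rw [hwval ⟨_, hmem⟩ ψ hψN rfl]
      exact congrArg _ (Subtype.ext hψγ)
    have htors : ∃ k : ℕ, p ^ k • (⟨_, hmem⟩ : subgroupResKer M N) = 0 := by
      refine ⟨k, hw ?_⟩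
      rw [map_nsmul, map_zero, hwx, ← QuotientAddGroup.mk_nsmul, QuotientAddGroup.eq_zero_iff]
      exact ⟨y, hy⟩
    exact ⟨⟨⟨_, hmem⟩, htors⟩, Subtype.ext hwx⟩
  exact Nat.card_congr (Equiv.ofBijective f ⟨hf, hfsurj⟩)

end Generic

/-! ## §2 The local tower kernel at any layer, given the cocycles -/

section Local

variable {K : Type u} [Field K] (W : WeierstrassCurve K) {p : ℕ} [hp : Fact p.Prime]
  (κ : ZpExtension K p) (E : Type u) [Field E] [Algebra K E]

/-- **`#𝒦_{E,n}[p^∞] = #(E(K̄_E)^{H_{E,∞}}/(g − 1))[p^∞]` given the inflation cocycles** — the EQUALITY form of the tree's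
`finite_localTowerKerPrimary_and_card_le` / `MultTowerNS2.finite_torsionBy_localTowerKerPrimary_and_card_le` at ANY layer `n`,
for a `g ∈ H_{E,n}` generating `H_{E,n}` topologically together with `H_{E,∞}`, whenever every relation `p^k • x = g • y − y`
between `H_{E,∞}`-fixed points is realised by a continuous cocycle on `H_{E,n}` vanishing on `H_{E,∞}` with value `x` at `g`,
and the right side is finite. (`𝒦_{E,n} = ker(res : H¹(H_{E,n}, E(K̄_E)) → H¹(H_{E,∞}, ·))` transported to the tree's
subgroup-kernel as in `Rank1Residual.Additive.natCard_localTowerKerPrimary_zero_eq`, then §1.)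
[cite: GreenbergLNM1716, §3 Lemma 3.1 (p. 86) and Lemma 3.4 (p. 89)] -/
theorem natCard_localTowerKerPrimary_eq_of_cocycles (n : ℕ) {g : Field.absoluteGaloisGroup E}
    (hg : g ∈ localSubgroup (κ.layerSubgroup n) E)
    (hgen : ∀ U : Subgroup (Field.absoluteGaloisGroup E),
      IsOpen (U : Set (Field.absoluteGaloisGroup E)) → localSubgroup κ.kerSubgroup E ≤ U →
        g ∈ U → localSubgroup (κ.layerSubgroup n) E ≤ U)
    (hinf : ∀ (x y : localPoints W E), (∀ τ ∈ localSubgroup κ.kerSubgroup E, τ • x = x) →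
      (∀ τ ∈ localSubgroup κ.kerSubgroup E, τ • y = y) → ∀ k : ℕ, p ^ k • x = g • y - y →
      ∃ ψ : contOneCocycles (discreteTopRep (localSubgroup (κ.layerSubgroup n) E) (localPoints W E)),
        (∀ (τ : Field.absoluteGaloisGroup E) (hτ : τ ∈ localSubgroup κ.kerSubgroup E),
          ψ.1 ⟨τ, WeierstrassCurve.localSubgroup_ker_le_layer κ E n hτ⟩ = 0) ∧
        ψ.1 ⟨g, hg⟩ = x)
    [Finite (AddCommGroup.primaryComponent
      (FixedPoints.addSubgroup (localSubgroup κ.kerSubgroup E) (localPoints W E) ⧸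
        (subOne (localSubgroup κ.kerSubgroup E) (localPoints W E) g).range) p)] :
    Nat.card (W.localTowerKerPrimary κ E n) =
      Nat.card (AddCommGroup.primaryComponent
        (FixedPoints.addSubgroup (localSubgroup κ.kerSubgroup E) (localPoints W E) ⧸
          (subOne (localSubgroup κ.kerSubgroup E) (localPoints W E) g).range) p) := by
  -- notation (as in the tree's `finite_localTowerKerPrimary_and_card_le`)
  let P : Type u := localPoints W E
  let Hn : Subgroup (Field.absoluteGaloisGroup E) := localSubgroup (κ.layerSubgroup n) E
  let Hi : Subgroup (Field.absoluteGaloisGroup E) := localSubgroup κ.kerSubgroup E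
  let N : Subgroup Hn := Hi.subgroupOf Hn
  let γ : Hn := ⟨g, hg⟩
  have hle : Hi ≤ Hn := WeierstrassCurve.localSubgroup_ker_le_layer κ E n
  -- (1) generation inside `H_{E,n}`
  have hgen' : ∀ U : Subgroup Hn, IsOpen (U : Set Hn) → N ≤ U → γ ∈ U → U = ⊤ := by
    intro U hU hNU hγU
    let U' : Subgroup (Field.absoluteGaloisGroup E) := U.map Hn.subtype
    have hopen : IsOpen (U' : Set (Field.absoluteGaloisGroup E)) :=
      (isOpen_localSubgroup_layerSubgroup E κ n).isOpenMap_subtype_val _ hU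
    have hN' : Hi ≤ U' := fun τ hτ ↦
      ⟨⟨τ, hle hτ⟩, hNU (Subgroup.mem_subgroupOf.mpr hτ), rfl⟩
    have hγU' : g ∈ U' := ⟨γ, hγU, rfl⟩
    have hle' := hgen U' hopen hN' hγU'
    rw [eq_top_iff]
    intro x _
    obtain ⟨u, hu, hux⟩ := hle' x.2
    have : u = x := Subtype.ext hux
    exact this ▸ hu
  -- (2) orbit maps on `H_{E,n}`
  have hcont : ∀ m : P, Continuous fun x : Hn ↦ x • m := fun m ↦
    (continuous_smul_localPoints W E m).comp continuous_subtype_val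
  -- (3) `P^N = P^{H_{E,∞}}`, compatibly with `g − 1` and `p`-power torsion
  have hfix : FixedPoints.addSubgroup N P = FixedPoints.addSubgroup Hi P := by
    ext m
    simp only [FixedPoints.mem_addSubgroup]
    constructor
    · intro h τ
      exact h ⟨⟨τ, hle τ.2⟩, Subgroup.mem_subgroupOf.mpr τ.2⟩
    · intro h x
      exact h ⟨((x : Hn) : Field.absoluteGaloisGroup E), Subgroup.mem_subgroupOf.mp x.2⟩
  let e : FixedPoints.addSubgroup N P ≃+ FixedPoints.addSubgroup Hi P :=
    AddEquiv.addSubgroupCongr hfix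
  have he : AddSubgroup.map (e : FixedPoints.addSubgroup N P →+ FixedPoints.addSubgroup Hi P)
      (subOne N P γ).range = (subOne Hi P g).range := by
    ext b
    constructor
    · rintro ⟨x, ⟨y, rfl⟩, rfl⟩
      exact ⟨e y, Subtype.ext rfl⟩
    · rintro ⟨y, rfl⟩
      exact ⟨subOne N P γ (e.symm y), ⟨e.symm y, rfl⟩, Subtype.ext rfl⟩
  let eq : FixedPoints.addSubgroup N P ⧸ (subOne N P γ).range ≃+
      FixedPoints.addSubgroup Hi P ⧸ (subOne Hi P g).range :=
    QuotientAddGroup.congr _ _ e he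
  let ep : AddCommGroup.primaryComponent (FixedPoints.addSubgroup N P ⧸ (subOne N P γ).range) p ≃
      AddCommGroup.primaryComponent (FixedPoints.addSubgroup Hi P ⧸ (subOne Hi P g).range) p :=
    eq.toEquiv.subtypeEquiv fun a ↦ by
      simp only [AddCommGroup.mem_primaryComponent, AddEquiv.toEquiv_eq_coe, EquivLike.coe_coe]
      constructor
      · rintro ⟨k, hk⟩
        exact ⟨k, by rw [← map_nsmul, hk, map_zero]⟩
      · rintro ⟨k, hk⟩
        refine ⟨k, eq.injective ?_⟩
        rw [map_nsmul, hk, map_zero]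
  haveI : Finite (AddCommGroup.primaryComponent
      (FixedPoints.addSubgroup N P ⧸ (subOne N P γ).range) p) := Finite.of_equiv _ ep.symm
  have hcardp : Nat.card (AddCommGroup.primaryComponent
      (FixedPoints.addSubgroup N P ⧸ (subOne N P γ).range) p) =
      Nat.card (AddCommGroup.primaryComponent
        (FixedPoints.addSubgroup Hi P ⧸ (subOne Hi P g).range) p) :=
    Nat.card_congr ep
  -- (hinf) transported to `N`
  have hinfN : ∀ (x y : FixedPoints.addSubgroup N P) (k : ℕ), p ^ k • x = subOne N P γ y →
      ∃ ψ : contOneCocycles (discreteTopRep Hn P), (∀ n ∈ N, ψ.1 n = 0) ∧ ψ.1 γ = x := by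
    intro x y k hk
    have hxfix : ∀ τ ∈ Hi, τ • (x : P) = x := fun τ hτ ↦ (e x).2 ⟨τ, hτ⟩
    have hyfix : ∀ τ ∈ Hi, τ • (y : P) = y := fun τ hτ ↦ (e y).2 ⟨τ, hτ⟩
    have hk' : p ^ k • (x : P) = g • (y : P) - y := by
      have := congrArg (fun z : FixedPoints.addSubgroup N P ↦ (z : P)) hk
      simp only [AddSubgroupClass.coe_nsmul, coe_subOne_apply] at this
      exact this
    obtain ⟨ψ, hψN, hψg⟩ := hinf (x : P) (y : P) hxfix hyfix k hk'
    refine ⟨ψ, fun ν hν ↦ ?_, hψg⟩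
    have h := hψN ((ν : Hn) : Field.absoluteGaloisGroup E) (Subgroup.mem_subgroupOf.mp hν)
    have en : (⟨((ν : Hn) : Field.absoluteGaloisGroup E),
        WeierstrassCurve.localSubgroup_ker_le_layer κ E n (Subgroup.mem_subgroupOf.mp hν)⟩ : Hn) = ν :=
      Subtype.ext rfl
    rwa [en] at h
  -- (4) the generic count on `H_{E,n}`
  have hcount := natCard_primary_subgroupResKer_eq_of_cocycles N P γ hgen' hcont p hinfN
  -- (5) `𝒦_{E,n} = ker (res : H¹(H_{E,n}, P) → H¹(N, P))`
  let j : N →ₜ* Hi :=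
    { toFun := fun x ↦ ⟨((x : Hn) : Field.absoluteGaloisGroup E), Subgroup.mem_subgroupOf.mp x.2⟩
      map_one' := rfl
      map_mul' := fun _ _ ↦ rfl
      continuous_toFun :=
        (continuous_subtype_val.comp continuous_subtype_val).subtype_mk _ }
  have hcomp : (resH1Hom j (AddMonoidHom.id P) (fun _ _ ↦ rfl)).comp
      (Literature.NumberTheory.EllipticCurves.resOfLe P hle) = resSubgroup N P := by
    unfold Literature.NumberTheory.EllipticCurves.resOfLe ResKernel.resSubgroup
    rw [resH1Hom_comp]
    exact resH1Hom_congr (ContinuousMonoidHom.ext fun _ ↦ rfl) (AddMonoidHom.ext fun _ ↦ rfl) _ _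
  have hker : W.localTowerKer κ E n = subgroupResKer P N := by
    apply le_antisymm
    · intro c hc
      rw [mem_subgroupResKer_iff, ← hcomp, AddMonoidHom.comp_apply,
        (W.mem_localTowerKer_iff κ E n c).mp hc, map_zero]
    · intro c hc
      obtain ⟨φ, rfl, hφN⟩ := exists_cocycle_of_res_eq_zero N P hcont c hc
      rw [W.mem_localTowerKer_iff κ E n]
      change Literature.NumberTheory.EllipticCurves.resOfLe P hle (oneCocycleClass _ φ) = 0
      have h0 : oneCocycleClass _ (contOneCocycles.pullback (subgroupInclusion hle)
          (resHomOfEquivariant (subgroupInclusion hle) (AddMonoidHom.id P) (fun _ _ ↦ rfl)) φ) = 0 := by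
        rw [oneCocycleClass_eq_zero_iff]
        refine ⟨0, fun τ ↦ ?_⟩
        rw [map_zero, sub_zero, contOneCocycles.pullback_apply]
        exact hφN ⟨(τ : Field.absoluteGaloisGroup E), hle τ.2⟩ (Subgroup.mem_subgroupOf.mpr τ.2)
      rw [← map_oneCocycleClass] at h0
      exact h0
  -- (6) `𝒦_{E,n}[p^∞] ≃ {x ∈ ker res | p-power torsion}`
  let f : W.localTowerKerPrimary κ E n ≃ {x : subgroupResKer P N // ∃ k : ℕ, p ^ k • x = 0} :=
    { toFun := fun c ↦ ⟨⟨(c : discreteH1 Hn P), hker.le ((W.mem_localTowerKerPrimary_iff κ E n _).mp c.2).1⟩, by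
        obtain ⟨k, hk⟩ := ((W.mem_localTowerKerPrimary_iff κ E n _).mp c.2).2
        exact ⟨k, Subtype.ext hk⟩⟩
      invFun := fun x ↦ ⟨((x.1 : subgroupResKer P N) : discreteH1 Hn P),
        (W.mem_localTowerKerPrimary_iff κ E n _).mpr ⟨hker.symm.le x.1.2, by
          obtain ⟨k, hk⟩ := x.2
          exact ⟨k, by
            have := congrArg (fun z : subgroupResKer P N ↦ (z : discreteH1 Hn P)) hk
            simpa only [AddSubgroupClass.coe_nsmul, ZeroMemClass.coe_zero] using this⟩⟩⟩
      left_inv := fun c ↦ Subtype.ext rfl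
      right_inv := fun x ↦ Subtype.ext (Subtype.ext rfl) }
  rw [Nat.card_congr f, hcount, hcardp]

end Local

/-! ## §3 At a place of `ℚ` above `p`, cyclotomic tower: the inflated cocycles exist (GEN 20 BRICK B′ with `A₁ = E(K̄_v)`) -/

variable {p : ℕ} [hp : Fact p.Prime] {κ : ZpExtension ℚ p}

/-- **Greenberg's `ker(r_{v_n}) ≅ H¹` EXACTLY at `v ∣ p`: `#𝒦_{v,n}[p^∞] = #(E(K̄_v)^{H_∞}/(g − 1))[p^∞]`** for EVERY
`W/ℚ`, the cyclotomic `ℤ_p`-extension `κ`, a place `v ∋ p`, any layer `n` and any `g ∈ H_n` generating `H_n` topologically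
together with `H_∞`, whenever the right side is finite. The cocycles of §2 are this lineage's
`exists_contOneCocycles_inflate_pow_of_fixed` for the `Γ`-stable subgroup `A₁ = ⊤`: its finite-level hypothesis holds because
the `H_∞`-fixed `p^k`-torsion points form a finite set (`E[p^k]` is finite, `finite_torsionBy_of_isAlgClosed`), each fixed by
some layer group (`exists_forall_mem_localSubgroup_layerSubgroup_smul_point_eq`), and the layer groups decrease.
[cite: GreenbergLNM1716, §3 Lemma 3.1 (p. 86) and Lemma 3.4 (p. 89)] [cite: SerreLocalFields1979, XIII §1 Prop. 1] -/
theorem natCard_localTowerKerPrimary_eq_coinv_atP (hκ : κ.IsCyclotomic) (v : HeightOneSpectrum (𝓞 ℚ))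
    (hv : ((p : ℕ) : 𝓞 ℚ) ∈ v.asIdeal) (W : WeierstrassCurve ℚ) [W.IsElliptic] (n : ℕ)
    {g : absoluteGaloisGroup (v.adicCompletion ℚ)}
    (hg : g ∈ localSubgroup (κ.layerSubgroup n) (v.adicCompletion ℚ))
    (hgen : ∀ U : Subgroup (absoluteGaloisGroup (v.adicCompletion ℚ)),
      IsOpen (U : Set (absoluteGaloisGroup (v.adicCompletion ℚ))) →
        localSubgroup κ.kerSubgroup (v.adicCompletion ℚ) ≤ U → g ∈ U →
          localSubgroup (κ.layerSubgroup n) (v.adicCompletion ℚ) ≤ U)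
    [Finite (AddCommGroup.primaryComponent
      (FixedPoints.addSubgroup (localSubgroup κ.kerSubgroup (v.adicCompletion ℚ)) (localPoints W (v.adicCompletion ℚ)) ⧸
        (subOne (localSubgroup κ.kerSubgroup (v.adicCompletion ℚ)) (localPoints W (v.adicCompletion ℚ)) g).range) p)] :
    Nat.card (W.localTowerKerPrimary κ (v.adicCompletion ℚ) n) =
      Nat.card (AddCommGroup.primaryComponent
        (FixedPoints.addSubgroup (localSubgroup κ.kerSubgroup (v.adicCompletion ℚ)) (localPoints W (v.adicCompletion ℚ)) ⧸
          (subOne (localSubgroup κ.kerSubgroup (v.adicCompletion ℚ)) (localPoints W (v.adicCompletion ℚ)) g).range) p) := by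
  -- notation
  let K := v.adicCompletion ℚ
  let P : Type := localPoints W K
  let Hi : Subgroup (absoluteGaloisGroup K) := localSubgroup κ.kerSubgroup K
  refine natCard_localTowerKerPrimary_eq_of_cocycles W κ K n hg hgen fun x y hx hy k hrel ↦ ?_
  -- a finite level `m₀` fixing every `H_∞`-fixed `p^k`-torsion point
  haveI : (W.baseChange (AlgebraicClosure K)).IsElliptic := by
    rw [baseChange]; infer_instance
  haveI hfinT : Finite (AddSubgroup.torsionBy P ((p ^ k : ℕ) : ℤ)) :=
    WeierstrassCurve.finite_torsionBy_of_isAlgClosed (V := W.baseChange (AlgebraicClosure K))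
      (n := ((p ^ k : ℕ) : ℤ)) (by exact_mod_cast pow_ne_zero k hp.out.ne_zero)
  have hlev : ∀ z : AddSubgroup.torsionBy P ((p ^ k : ℕ) : ℤ), (∀ h ∈ Hi, h • (z : P) = z) →
      ∃ m : ℕ, ∀ h ∈ localSubgroup (κ.layerSubgroup m) K, h • (z : P) = z := fun z hz ↦
    exists_forall_mem_localSubgroup_layerSubgroup_smul_point_eq (κ := κ) v W (z : P) hz
  letI : Fintype (AddSubgroup.torsionBy P ((p ^ k : ℕ) : ℤ)) := Fintype.ofFinite _
  let mfun : AddSubgroup.torsionBy P ((p ^ k : ℕ) : ℤ) → ℕ := fun z ↦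
    if hz : (∀ h ∈ Hi, h • (z : P) = z) then (hlev z hz).choose else 0
  let m₀ : ℕ := Finset.univ.sup mfun
  have hZ : ∀ a ∈ (⊤ : AddSubgroup P), p ^ k • a = 0 → (∀ h ∈ Hi, h • a = a) →
      ∀ h ∈ localSubgroup (κ.layerSubgroup m₀) K, h • a = a := by
    intro a _ hak hai h hh
    have haZ : a ∈ AddSubgroup.torsionBy P ((p ^ k : ℕ) : ℤ) :=
      AddSubgroup.torsionBy.nsmul_iff.mpr hak
    have hspec := (hlev ⟨a, haZ⟩ hai).choose_spec
    have hle : mfun ⟨a, haZ⟩ ≤ m₀ := Finset.le_sup (f := mfun) (Finset.mem_univ _)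
    have hm : mfun ⟨a, haZ⟩ = (hlev ⟨a, haZ⟩ hai).choose := dif_pos hai
    rw [hm] at hle
    exact hspec h (MultTowerSP1.localSubgroup_layerSubgroup_antitone κ K hle hh)
  obtain ⟨c, hcN, hcg, -, -⟩ := exists_contOneCocycles_inflate_pow_of_fixed hκ v hv W n k m₀ hg hgen ⊤
    (fun _ _ _ ↦ AddSubgroup.mem_top _) hZ (AddSubgroup.mem_top x) hx hy hrel
  exact ⟨c, fun τ hτ ↦ hcN ⟨τ, _⟩ hτ, hcg⟩

end Summit.BirchSwinnertonDyer.BirchSwinnertonDyer.Theorems.GoodOrdTower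

end
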